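import Literature.AnabelianGeometry.AbsoluteAnabelian.PuncturedEllipticCurveUniversalCover
import Literature.AnabelianGeometry.AbsoluteAnabelian.HolomorphicCoresIdComponentProofs
import Literature.AnabelianGeometry.AbsoluteAnabelian.HolomorphicCoresProofs
import HarnessLib

/-!
# [AbsTopIII] Cor. 2.4 (b)(c) at the genuine once-punctured elliptic curve

Layer `Literature/AnabelianGeometry/AbsoluteAnabelian`, PROOF-ONLY (abc-iut cell, seat abc-iut-L4-t8, programme
«UNIF-G1P», GAP G-L4t8g7-1).  S. Mochizuki, *Topics in Absolute Anabelian Geometry III*, Cor. 2.4 (b)(c)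
pp. 54–55: for «a hyperbolic Aut-holomorphic space of finite type» with universal covering `𝕌 → 𝕏`,
«we obtain a natural injection `π₁(X^top) = Aut(U^top/X^top) ↪ Aut⁰(𝕌) ⊆ Aut(𝕌)`» (b) and, `X` not
arithmetic, «the Aut-holomorphic orbispace `𝕏 → ℍ` associated to the hyperbolic core … by forming the
'orbispace quotient' of `U^top` by `Π`» (c).  The tree's typed forms `DeckGroupInAutIdComponent`,
`HyperbolicCoreOrbispace` (`HolomorphicCores.lean`) are PROVED (`DeckGroupInAutIdComponent_holds`,
`HyperbolicCoreOrbispace_holds`) for every `(X, Ucov, p)` satisfying their hypotheses; this file SUPPLIES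
those hypotheses at the genuine curve of type `(1,1)` — the once-punctured elliptic curve `X_K` of
[IUTchI] Def. 3.1 (b), typed as `TorsionPointsDenseUniqueGroupLaw.IsPuncturedEllipticCurve E` — using the
holomorphic universal covering by the disc of the programme «UNIF-G1P»
(`exists_disc_covering_of_isPuncturedEllipticCurve`, conditional on the classical named fact
`Complex.PlaneDomainDiscCovering`):

* `isOfFiniteType_of_isPuncturedEllipticCurve` — a punctured elliptic curve is a Riemann surface of finite
  type (`IsOfFiniteType`: compactification `T`, one point removed);
* `exists_deckGroup_subset_autIdComponent_of_isPuncturedEllipticCurve` — **Cor. 2.4 (b) at genuine `E`**: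
  a holomorphic universal covering `p : 𝔻 → E` whose deck group `π₁(E) = Aut(𝔻/E)` lies in `Aut⁰(𝔻)`;
* `exists_hyperbolicCore_data_of_isPuncturedEllipticCurve` — **Cor. 2.4 (c) at genuine `E`**: for such
  `p` and `G = Aut⁰(𝔻)`, IF `π₁(E)` is non-arithmetic in the commensurator sense
  (`IsMargulisNonArithmetic`, the printed hypothesis «`X` is not arithmetic», kept as a hypothesis) then
  the commensurator `Π` acts properly discontinuously with finite stabilisers by automorphisms of `𝔻`.

HONEST FRAMING: instantiation of the tree's theorems at a genuine object; conditional on one classical named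
fact; nothing here bears on the disputed [IUTchIII] Cor. 3.12.

v2 (doc-only, referee note K28-n2): the header quote of the Cor. 2.4 hypothesis previously read «… orbispace of
finite type»; print p. 54 reads «Let `𝕏` be a hyperbolic Aut-holomorphic space of finite type associated to a
Riemann surface `X`» — the Aut-holomorphic ORBISPACE is the OUTPUT of (c).  Quote corrected; declarations
unchanged (the typed `E` is a space).
-/

noncomputable section

open Set Function Metric TopologicalSpace
open scoped Manifold ContDiff Topology

namespace Literature.AnabelianGeometry.AbsoluteAnabelian

namespace HolomorphicEllipticCuspidalization

variable (E : Type) [TopologicalSpace E] [ChartedSpace ℂ E]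

/-- Packaging a `FiniteTypeWitness` from a homeomorphism onto an open subset EQUAL to the complement of
a finset (lets us `subst` the equality of open sets). [cite: MochizukiAbsTopIII2015, Corollary 2.4 p.54] -/
private theorem isOfFiniteType_of_eq {T : Type} [TopologicalSpace T] [T2Space T] [CompactSpace T]
    [ConnectedSpace T] [ChartedSpace ℂ T] [IsManifold 𝓘(ℂ, ℂ) ω T] (S : Finset T) (V : Opens T)
    (hV : (⟨((S : Set T))ᶜ, S.finite_toSet.isClosed.isOpen_compl⟩ : Opens T) = V) (e : E ≃ₜ V)
    (hol : MDifferentiable 𝓘(ℂ, ℂ) 𝓘(ℂ, ℂ) e) (hol_symm : MDifferentiable 𝓘(ℂ, ℂ) 𝓘(ℂ, ℂ) e.symm) :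
    IsOfFiniteType E := by
  subst hV
  exact ⟨{ Xc := T, S := S, e := e, hol := hol, hol_symm := hol_symm }⟩

/-- **A punctured elliptic curve is a Riemann surface of finite type** (compactification: the genus-one
surface `T` of the typed hypothesis, with the single point `t₀` removed). [cite: MochizukiAbsTopIII2015, Corollary 2.4 p.54] -/
theorem isOfFiniteType_of_isPuncturedEllipticCurve
    (hE : TorsionPointsDenseUniqueGroupLaw.IsPuncturedEllipticCurve E) : IsOfFiniteType E := by
  classical
  obtain ⟨T, _, _, _, _, _, _, t₀, e, -, he, hesymm⟩ := hE
  let V₀ : Opens T := ⟨{t₀}ᶜ, isOpen_compl_singleton⟩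
  let e₀ : E ≃ₜ V₀ := e
  have hV : (⟨((({t₀} : Finset T) : Set T))ᶜ,
      ({t₀} : Finset T).finite_toSet.isClosed.isOpen_compl⟩ : Opens T) = V₀ := by
    ext x
    simp [V₀]
  refine isOfFiniteType_of_eq E {t₀} V₀ hV e₀ ?_ ?_
  · -- holomorphy of `E → V₀`: its composite with `V₀ ⊆ T` is the typed holomorphic map
    intro x
    have h1 : MDifferentiableAt 𝓘(ℂ, ℂ) 𝓘(ℂ, ℂ) (Subtype.val ∘ (e₀ : E → V₀)) x ↔
        MDifferentiableAt 𝓘(ℂ, ℂ) 𝓘(ℂ, ℂ) (e₀ : E → V₀) x :=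
      ChartedSpace.liftPropWithinAt_subtypeVal_comp_iff ..
    rw [← h1]
    exact he x
  · -- holomorphy of `V₀ → E` is the typed third clause (same map)
    exact hesymm

/-- **[AbsTopIII] Cor. 2.4 (b) at the genuine once-punctured elliptic curve** («a natural injection
`π₁(X^top) = Aut(U^top/X^top) ↪ Aut⁰(𝕌) ⊆ Aut(𝕌)`»), conditional on `Complex.PlaneDomainDiscCovering`:
`E` has a surjective holomorphic universal covering `p : 𝔻 → E` by the unit disc, and every deck
transformation of `p` lies in the identity component `Aut⁰(𝔻)` of the automorphism group of the
Aut-holomorphic disc (compact-open topology) — `DeckGroupInAutIdComponent_holds` instantiated at the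
genuine object. [cite: MochizukiAbsTopIII2015, Corollary 2.4 (b) p.54] -/
theorem exists_deckGroup_subset_autIdComponent_of_isPuncturedEllipticCurve [T2Space E]
    [IsManifold 𝓘(ℂ, ℂ) ω E] (H : Complex.PlaneDomainDiscCovering)
    (hE : TorsionPointsDenseUniqueGroupLaw.IsPuncturedEllipticCurve E) :
    ∃ p : unitDiscOpens → E, IsCoveringMap p ∧ Function.Surjective p ∧
      MDifferentiable 𝓘(ℂ, ℂ) 𝓘(ℂ, ℂ) p ∧
      ((deckGroup p : Subgroup (unitDiscOpens ≃ₜ unitDiscOpens)) :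
          Set (unitDiscOpens ≃ₜ unitDiscOpens)) ⊆
        autIdComponent (AutHolStructure.ofCharted unitDiscOpens) := by
  obtain ⟨p, hp, hsurj, hpd⟩ := exists_disc_covering_of_isPuncturedEllipticCurve E H hE
  haveI : ContractibleSpace unitDiscOpens := by
    unfold unitDiscOpens
    exact (convex_ball (0 : ℂ) 1).contractibleSpace ⟨0, mem_ball_self one_pos⟩
  haveI : SimplyConnectedSpace unitDiscOpens := SimplyConnectedSpace.ofContractible _
  have hdisc : IsAutHolDisc unitDiscOpens := ⟨⟨Homeomorph.refl _, mdifferentiable_id, mdifferentiable_id⟩⟩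
  exact ⟨p, hp, hsurj, hpd, DeckGroupInAutIdComponent_holds E unitDiscOpens p
    (isOfFiniteType_of_isPuncturedEllipticCurve E hE) hp hsurj hpd hdisc⟩

/-- **[AbsTopIII] Cor. 2.4 (c) at the genuine once-punctured elliptic curve** («if `X` is not arithmetic
… the hyperbolic core … the orbispace quotient of `U^top` by `Π`»), conditional on
`Complex.PlaneDomainDiscCovering` and on the printed non-arithmeticity hypothesis (typed
`IsMargulisNonArithmetic`, kept as a hypothesis on the deck group in `G = Aut⁰(𝔻)`): for the holomorphic
universal covering `p : 𝔻 → E`, the commensurator `Π` of `π₁(E) = Aut(𝔻/E)` in `Aut⁰(𝔻)` acts on `𝔻`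
properly discontinuously (finitely many `γ ∈ Π` move a compact set to meet another), with finite
stabilisers, by automorphisms of the Aut-holomorphic disc — `HyperbolicCoreOrbispace_holds` instantiated
at the genuine object. [cite: MochizukiAbsTopIII2015, Corollary 2.4 (c) p.55] -/
theorem exists_hyperbolicCore_data_of_isPuncturedEllipticCurve [T2Space E] [IsManifold 𝓘(ℂ, ℂ) ω E]
    (H : Complex.PlaneDomainDiscCovering)
    (hE : TorsionPointsDenseUniqueGroupLaw.IsPuncturedEllipticCurve E) :
    ∃ p : unitDiscOpens → E, IsCoveringMap p ∧ Function.Surjective p ∧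
      MDifferentiable 𝓘(ℂ, ℂ) 𝓘(ℂ, ℂ) p ∧
      ∀ G : Subgroup (unitDiscOpens ≃ₜ unitDiscOpens),
        (G : Set (unitDiscOpens ≃ₜ unitDiscOpens)) =
            autIdComponent (AutHolStructure.ofCharted unitDiscOpens) →
        IsMargulisNonArithmetic G (deckGroup p) →
        let Pc : Subgroup (unitDiscOpens ≃ₜ unitDiscOpens) :=
          (Subgroup.Commensurable.commensurator ((deckGroup p).subgroupOf G)).map G.subtype
        (∀ K L : Set unitDiscOpens, IsCompact K → IsCompact L →
            {γ : unitDiscOpens ≃ₜ unitDiscOpens | γ ∈ Pc ∧ (γ '' K ∩ L).Nonempty}.Finite) ∧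
          (∀ x : unitDiscOpens, {γ : unitDiscOpens ≃ₜ unitDiscOpens | γ ∈ Pc ∧ γ x = x}.Finite) ∧
          ((Pc : Set (unitDiscOpens ≃ₜ unitDiscOpens)) ⊆
            autSet (AutHolStructure.ofCharted unitDiscOpens)) := by
  obtain ⟨p, hp, hsurj, hpd⟩ := exists_disc_covering_of_isPuncturedEllipticCurve E H hE
  haveI : ContractibleSpace unitDiscOpens := by
    unfold unitDiscOpens
    exact (convex_ball (0 : ℂ) 1).contractibleSpace ⟨0, mem_ball_self one_pos⟩
  haveI : SimplyConnectedSpace unitDiscOpens := SimplyConnectedSpace.ofContractible _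
  have hdisc : IsAutHolDisc unitDiscOpens := ⟨⟨Homeomorph.refl _, mdifferentiable_id, mdifferentiable_id⟩⟩
  exact ⟨p, hp, hsurj, hpd, fun G hG hna => HyperbolicCoreOrbispace_holds E unitDiscOpens p
    (isOfFiniteType_of_isPuncturedEllipticCurve E hE) hp hsurj hpd hdisc G hG hna⟩

end HolomorphicEllipticCuspidalization

end Literature.AnabelianGeometry.AbsoluteAnabelian

end
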